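/- LEAD seat `ym-line-cbag-p1` (prover-ym-line-cbag-p1-g28-0; own crux stmt-QuantumFields-22254 `BoxFloorAllGroups` CLOSED·proved),
LINE 7 `GlueballBandRecursion`, item ⟨stmt-QuantumFields-22957⟩ `OneParticleBlochSymbolFamily` (= `Band.EffectiveBlochSymbolFamily`):
part 2/2 of the LEAD's share of the planner's stub S2 `blochSymbolOfCovariantFamily` (STUB-PLAN-22957, 2026-08-28T18:17Z): the BLOCH
REDUCTION of a translation-covariant orthonormal frame in eigenbasis form and its TRANSFER-MATRIX corollaries (complements the width seat
w4's def-free `…BlochReduction` / `…BlochCovariantFamily`, landed the same hour).  Route-independent (no `Theses` import); a helper. -/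
import Summits.QuantumFields.YangMills.Theorems.GlueballBandRecursionBlochMatrices
import Summits.QuantumFields.YangMills.Theorems.GlueballBandRecursionBlochCovariantFamily
import Summits.QuantumFields.YangMills.Theorems.GlueballBandRecursionOneGlueballBandDichotomyBandLevels
import Summits.QuantumFields.YangMills.Theorems.GlueballBandRecursionOneGlueballBandDichotomyBandTopFlat
import Literature.MathematicalPhysics.QuantumFieldTheory.WilsonTransferTranslations

/-!
# Route `GlueballBandRecursion`, item `OneParticleBlochSymbolFamily` (stmt-QuantumFields-22957): the Bloch reduction of a
# translation-covariant orthonormal frame (stub S2 `blochSymbolOfCovariantFamily` of the planner's stub plan, abstract form)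

The item (`Band.EffectiveBlochSymbolFamily`, Theorems/GlueballBandRecursionEffectiveBlochSymbolDefs.lean) asks, per `β` on the
strong-coupling window and `N ≥ L₀`, for a periodic Hermitian matrix symbol `B̃_N` whose values at the lattice angles
`θ_p = latticeAngle N p`, `p ∈ (Fin N)³`, control the cold thermal trace: (P4) `½·Σ_p Re tr B̃(θ_p)^t ≤ traceExcess ≤ 2·Σ_p …`.
The planner's stub plan (evidence `STUB-PLAN-22957-OneParticleBlochSymbolFamily.md`, 2026-08-28) splits its proof into S1 (the
N-uniform isolated one-particle band of `T̂ = 𝕋/λ₊` — the cluster expansion, XL), S2 (linear algebra: a translation-covariant frame of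
the band yields Hermitian momentum blocks `B_N(p)` carrying the band eigenvalues), S3 (one smooth periodic symbol through the
`B_N(p)`), S4 (the dilute-gas upper half of (P4)).  THIS FILE (with part 1, `GlueballBandRecursionBlochMatrices.lean`, §1–§3) is S2 in a form that does not depend on how S1 will be typed.
Relation to the width seat w4's files landed the same hour (`…BlochReduction`: the same block-circulant algebra, definition-free, over
`(Fin N)³` with `cycleRoot` characters; `…BlochCovariantFamily`: hopping matrix of an orthonormal family, `Σ_i ⟪e_i, T^t e_i⟫ = tr A^t =
Σ_p tr B_p^t` for a covariant family and abstract isometries `U_a`): this file REUSES their frame trace formula and adds what they do not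
have — (a) the EIGENBASIS form `Σ_k μ_k^t` for an arbitrary orthonormal eigenbasis of the band subspace (basis independence), (b) the
specialisation to the tree's TRANSFER MATRIX with the Koopman translations of `WilsonTransferTranslations` (positions indexed by
`Site 3 N = Fin 3 → ZMod N`, the index of `configTranslate`, via part 1's `Tor`/`dft` formalism), Hermitian transfer Bloch blocks, and
(c) the LOWER HALF of the item's (P4) for any covariant excited frame, (d) the `(Fin N)³` indexing and the phase convention for S3.

* §1–§2 (part 1; pure matrix algebra over `ℂ`, any finite torus `T = Π_μ ℤ/N_μ`, reusing the tree's characters `chi` and unitary `dft`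
  of `Balaban1983to89.B5Prop11Plancherel`): for ANY matrix kernel `h : T → Mat_n(ℂ)` the block-circulant matrix
  `C[(x,i),(y,j)] = h(y − x)_{ij}` is block-diagonalised by the block DFT, `F C F^* = ⊕_p B(p)` with the **Bloch matrices**
  `B(p) = Σ_x e^{ip·x} h(x)` (`dftBlock_conj_blockCirculant`), hence the **trace identity** `tr C^t = Σ_p tr B(p)^t` for every
  `t` (`trace_pow_blockCirculant`); §3: `h(−x) = h(x)ᴴ` ⇒ every `B(p)` Hermitian.
* §4 (any real inner-product space): Parseval in the span of a finite orthonormal family, and for a finite orthonormal frame `ψ` spanning a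
  `T`-invariant subspace `V` and ANY orthonormal eigenbasis `e_k`, `μ_k` of `V`: `Σ_k μ_k^t = tr(C^t)`, `C[a,b] = ⟪ψ_a, Tψ_b⟫`
  (`sum_eigenvalue_pow_eq_trace_frameMatrix_pow`; no symmetry of `T` needed).
* §5: if the frame is indexed by `T × Fin n` and its matrix is translation invariant, `⟪ψ_{(x,i)}, Tψ_{(y,j)}⟫ = h(y − x)_{ij}`, then
  `Σ_k μ_k^t = Σ_p Re tr B(p)^t` (`sum_eigenvalue_pow_eq_sum_re_trace_blochMatrix_pow`): the band eigenvalues with multiplicity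
  ARE the eigenvalues of the Bloch blocks — the content of stub S2.
* §6 (the tree's transfer matrix `𝕋 = wilsonTorusTransferMatrix r.ρ β N` on the real `L²(G^{E₃})`, translations = the Koopman
  isometries of `configTranslate`, which commute with `𝕋` by `WilsonTransferTranslations` — the stub plan's typing prerequisite
  D1, in the tree since g23): a translation-COVARIANT orthonormal frame `ψ_{(v+x,j)} = U_v ψ_{(x,j)}` has a translation-invariant
  matrix (`inner_transfer_covariant`), a reflection-symmetric normalised hopping kernel `J(z) = ⟪ψ_{(0,·)}, 𝕋ψ_{(z,·)}⟫/λ₊`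
  (`transferKernel_reflect`), Hermitian Bloch matrices `B̂(p)` (`transferBloch_isHermitian`), `Σ_k (μ_k/λ₊)^t = Σ_p Re tr B̂(p)^t`
  (`transfer_bloch_reduction`), and — with the landed variational floor `sum_pow_div_le_traceExcess` — the LOWER HALF of (P4) with
  constant `1` for the Bloch blocks of any covariant EXCITED frame: `Σ_p Re tr B̂(p)^{m+2} ≤ traceExcess r.ρ β N (m+2)`
  (`sum_re_trace_transferBloch_pow_le_traceExcess`).
* §7: the item's indexing `p ∈ (Fin N)³` (`cubeEquivSite : (Fin N)³ ≃ (ℤ/N)³`, `sum_cube_re_trace_transferBloch_pow_le_traceExcess`)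
  and the phase convention for S3: `chi (cubeToSite p) z = exp(i Σ_μ θ_p(μ) z_μ)` (`chi_cubeToSite`), so a symbol
  `B̃(q) = Σ_z e^{i q·z̃} J(z)` with representatives `z̃ ≡ z (mod N)` satisfies `B̃(θ_p) = B̂(cubeToSite p)`.

Design.  Positions and momenta are both `Site 3 N = Fin 3 → ZMod N` (= `Tor (fun _ => N)`), the index of `configTranslate`; the
real `L²` is never complexified — only the finite frame matrix is mapped to `ℂ`.  The covariance hypothesis is stated in the strong
form `ψ_{(v+x,j)} = U_v ψ_{(x,j)}` (no group law of the Koopman operators is needed).  Deliberately NOT here: the existence of the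
band / frame (S1), the smooth symbol and its log-C² bounds (S3), the upper half of (P4) (S4) — i.e. nothing of the cluster expansion.

HONEST FRAMING.  Conditional plumbing for the XL item ⟨stmt-QuantumFields-22957⟩ of LINE 7; the item, the rung
`ColdDoublingRecursionStrongCoupling` (RECORD-type, strong coupling) and a fortiori the Yang–Mills mass gap / the summit `YangMills` are
NOT proved or advanced here.

References: Montvay–Münster (1994) §3.2.6 (momentum sectors of the transfer matrix); Reed–Simon IV §XIII.16 (Bloch/Floquet
decomposition); Bałaban–Feldman–Knörrer–Trubowitz, arXiv:1609.00964, Lemma 1 (periodic operators are block diagonal in momentum);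
R. Schor, Commun. Math. Phys. 92 (1984) 369 (the one-glueball band whose finite-torus version S1 would supply).
-/

set_option autoImplicit false

noncomputable section

open scoped InnerProductSpace BigOperators ComplexConjugate Matrix
open Finset
open Literature.MathematicalPhysics.QuantumFieldTheory.Balaban1983to89.B5Prop11Plancherel
  (Tor chi dft conj_chi chi_add_left chi_add_right sum_chi dft_mul_star chi_neg_neg)
open Summit.QuantumFields.YangMills.Theorems.GlueballBandRecursion.Bloch
  (sum_inner_pow_apply_eq_trace_pow pow_apply_of_apply_eq_smul)

namespace Summit.QuantumFields.YangMills.Theorems.GlueballBandRecursion.Band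

namespace Bloch

/-! ### §4 Hilbert-space bridge: eigenvalue power sums of an invariant subspace are traces of powers of the frame matrix -/

section Hilbert

variable {E : Type*} [NormedAddCommGroup E] [InnerProductSpace ℝ E]

/-- **Parseval in the span of a finite orthonormal family**: `v = Σ_a ⟪ψ_a, v⟫ ψ_a` for `v ∈ span ψ`. [folklore] -/
theorem eq_sum_inner_smul_of_mem_span {ι : Type*} [Fintype ι] {ψ : ι → E} (hψ : Orthonormal ℝ ψ) {v : E}
    (hv : v ∈ Submodule.span ℝ (Set.range ψ)) : v = ∑ a, ⟪ψ a, v⟫_ℝ • ψ a := by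
  obtain ⟨c, rfl⟩ := (Submodule.mem_span_range_iff_exists_fun ℝ).1 hv
  exact Finset.sum_congr rfl fun a _ => by rw [hψ.inner_right_fintype]

/-- Parseval for inner products in the span: `⟪w, v⟫ = Σ_a ⟪ψ_a, v⟫⟪w, ψ_a⟫` for `v ∈ span ψ`. [folklore] -/
theorem inner_eq_sum_of_mem_span {ι : Type*} [Fintype ι] {ψ : ι → E} (hψ : Orthonormal ℝ ψ) (w : E) {v : E}
    (hv : v ∈ Submodule.span ℝ (Set.range ψ)) : ⟪w, v⟫_ℝ = ∑ a, ⟪ψ a, v⟫_ℝ * ⟪w, ψ a⟫_ℝ := by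
  conv_lhs => rw [eq_sum_inner_smul_of_mem_span hψ hv]
  rw [inner_sum]
  exact Finset.sum_congr rfl fun a _ => real_inner_smul_right _ _ _

/-- Parseval for the norm in the span: `‖v‖² = Σ_a ⟪ψ_a, v⟫²` for `v ∈ span ψ`. [folklore] -/
theorem norm_sq_eq_sum_of_mem_span {ι : Type*} [Fintype ι] {ψ : ι → E} (hψ : Orthonormal ℝ ψ) {v : E}
    (hv : v ∈ Submodule.span ℝ (Set.range ψ)) : ‖v‖ ^ 2 = ∑ a, ⟪ψ a, v⟫_ℝ ^ 2 := by
  rw [← real_inner_self_eq_norm_sq, inner_eq_sum_of_mem_span hψ v hv]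
  exact Finset.sum_congr rfl fun a _ => by rw [real_inner_comm, sq]

/-- **Eigenvalue power sums are traces of powers of the frame matrix.**  Let `ψ : ι → E` be a finite orthonormal frame whose
span `V` is `T`-invariant, and `e : K → E` an orthonormal family of eigenvectors of `T` (`T e_k = μ_k e_k`) with the same span
(`e_k ∈ span ψ` and `ψ_a ∈ span e`).  Then for every `t`: `Σ_k μ_k^t = tr(C^t)`, `C[a,b] = ⟪ψ_a, T ψ_b⟫` — basis independence
of `tr_V (T|_V)^t`, combining w4's frame trace formula `Σ_a ⟪ψ_a, T^t ψ_a⟫ = tr(C^t)` (`Bloch.sum_inner_pow_apply_eq_trace_pow`) with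
Parseval in the eigenbasis.  (No symmetry of `T` is assumed; `t = 0` gives `|K| = |ι|`.) [folklore] -/
theorem sum_eigenvalue_pow_eq_trace_frameMatrix_pow {ι K : Type*} [Fintype ι] [DecidableEq ι] [Fintype K]
    (T : E →ₗ[ℝ] E) {ψ : ι → E} (hψ : Orthonormal ℝ ψ) (hTψ : ∀ b, T (ψ b) ∈ Submodule.span ℝ (Set.range ψ))
    {e : K → E} (he : Orthonormal ℝ e) {μ : K → ℝ} (hTe : ∀ k, T (e k) = μ k • e k)
    (he_mem : ∀ k, e k ∈ Submodule.span ℝ (Set.range ψ)) (hψ_mem : ∀ a, ψ a ∈ Submodule.span ℝ (Set.range e))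
    (t : ℕ) :
    ∑ k, μ k ^ t = ((Matrix.of fun a b => ⟪ψ a, T (ψ b)⟫_ℝ) ^ t).trace := by
  -- the trace in the frame `ψ` (w4's hopping-matrix trace formula, `…BlochCovariantFamily`)
  have htr : ((Matrix.of fun a b => ⟪ψ a, T (ψ b)⟫_ℝ) ^ t).trace = ∑ a, ⟪ψ a, (T ^ t) (ψ a)⟫_ℝ :=
    (sum_inner_pow_apply_eq_trace_pow ψ hψ T hTψ (Matrix.of fun a b => ⟪ψ a, T (ψ b)⟫_ℝ) (fun _ _ => rfl) t).symm
  -- expand each `ψ_a` in the eigenbasis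
  have hdiag : ∀ a, ⟪ψ a, (T ^ t) (ψ a)⟫_ℝ = ∑ k, μ k ^ t * ⟪ψ a, e k⟫_ℝ ^ 2 := by
    intro a
    have hx : (T ^ t) (ψ a) = ∑ k, ⟪e k, ψ a⟫_ℝ • (μ k ^ t • e k) := by
      conv_lhs => rw [eq_sum_inner_smul_of_mem_span he (hψ_mem a)]
      rw [map_sum]
      exact Finset.sum_congr rfl fun k _ => by rw [map_smul, pow_apply_of_apply_eq_smul T (e k) (μ k) (hTe k) t]
    rw [hx, inner_sum]
    refine Finset.sum_congr rfl fun k _ => ?_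
    rw [real_inner_smul_right, real_inner_smul_right, real_inner_comm (ψ a) (e k)]
    ring
  rw [htr]
  simp_rw [hdiag]
  rw [Finset.sum_comm]
  refine Finset.sum_congr rfl fun k _ => ?_
  rw [← Finset.mul_sum, ← norm_sq_eq_sum_of_mem_span hψ (he_mem k), he.1 k, one_pow, mul_one]

end Hilbert

/-! ### §5 The Bloch reduction of a translation-covariant orthonormal frame -/

section Reduction

variable {d : ℕ} {N : Fin d → ℕ} [∀ μ, NeZero (N μ)] {n : ℕ}
variable {E : Type*} [NormedAddCommGroup E] [InnerProductSpace ℝ E]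

/-- **Bloch reduction (stub S2 in abstract form).**  Let `T` be a linear operator on a real inner-product space, `ψ : T × Fin n → E`
(`T = Π_μ ℤ/N_μ` the torus) an orthonormal frame spanning a `T`-invariant subspace whose matrix is TRANSLATION INVARIANT,
`⟪ψ_{(x,i)}, T ψ_{(y,j)}⟫ = h(y − x)_{ij}` for a real matrix kernel `h` (this is what a translation-covariant frame
`ψ_{(x,i)} = U_x ψ_{(0,i)}` of an operator commuting with the unitary translations `U_x` gives, §6), and let `e_k`, `μ_k` be ANY
orthonormal eigenbasis of that subspace.  Then for every `t`:  `Σ_k μ_k^t = Σ_p Re tr B(p)^t`, where `B(p) = Σ_x e^{ip·x} h(x)`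
are the Bloch matrices (`n × n`, Hermitian when `h(−x) = h(x)ᵀ`, §3).  The eigenvalues of the band, with multiplicity, are
the eigenvalues of the Bloch blocks. [folklore] -/
theorem sum_eigenvalue_pow_eq_sum_re_trace_blochMatrix_pow {K : Type*} [Fintype K] (T : E →ₗ[ℝ] E)
    {ψ : Tor N × Fin n → E} (hψ : Orthonormal ℝ ψ) (hTψ : ∀ b, T (ψ b) ∈ Submodule.span ℝ (Set.range ψ))
    {h : Tor N → Matrix (Fin n) (Fin n) ℝ} (hker : ∀ (x : Tor N) (i : Fin n) (y : Tor N) (j : Fin n),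
      ⟪ψ (x, i), T (ψ (y, j))⟫_ℝ = h (y - x) i j)
    {e : K → E} (he : Orthonormal ℝ e) {μ : K → ℝ} (hTe : ∀ k, T (e k) = μ k • e k)
    (he_mem : ∀ k, e k ∈ Submodule.span ℝ (Set.range ψ)) (hψ_mem : ∀ a, ψ a ∈ Submodule.span ℝ (Set.range e))
    (t : ℕ) :
    ∑ k, μ k ^ t = ∑ p, ((blochMatrix N n (fun x => (h x).map Complex.ofReal) p ^ t).trace).re := by
  classical
  have h1 := sum_eigenvalue_pow_eq_trace_frameMatrix_pow T hψ hTψ he hTe he_mem hψ_mem t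
  -- the frame matrix is the (real) block-circulant matrix of `h`; complexify
  have hC : (Matrix.of fun a b => ⟪ψ a, T (ψ b)⟫_ℝ).map Complex.ofReal =
      blockCirculant N n (fun x => (h x).map Complex.ofReal) := by
    ext ⟨x, i⟩ ⟨y, j⟩
    simp only [Matrix.map_apply, Matrix.of_apply, blockCirculant_apply, hker]
  have hC' : (Matrix.of fun a b => ⟪ψ a, T (ψ b)⟫_ℝ).map (Complex.ofRealHom : ℝ →+* ℂ) =
      blockCirculant N n (fun x => (h x).map Complex.ofReal) := hC
  have h2 : ((∑ k, μ k ^ t : ℝ) : ℂ) = ∑ p, (blochMatrix N n (fun x => (h x).map Complex.ofReal) p ^ t).trace := by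
    rw [← trace_pow_blockCirculant, ← hC', ← Matrix.map_pow, h1]
    simp only [Matrix.trace, Matrix.diag, Matrix.map_apply, Complex.ofReal_sum, Complex.ofRealHom_eq_coe]
  rw [← Complex.ofReal_re (∑ k, μ k ^ t), h2, Complex.re_sum]

end Reduction

end Bloch

/-! ### §6 The transfer matrix: Bloch matrices of a translation-covariant orthonormal frame, and the lower half of (P4) -/

section Transfer

open MeasureTheory
open Literature.MathematicalPhysics.QuantumFieldTheory
open Bloch

variable {G : Type} [Group G] [TopologicalSpace G] [IsTopologicalGroup G] [CompactSpace G]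
  [MeasurableSpace G] [BorelSpace G]

/-- The **Koopman isometry of the spatial translation** by `v ∈ (ℤ/N)³` on the time-zero space `L²(G^{E₃}, ∏ dHaar)`,
`φ ↦ φ ∘ T_v` (tree: `configTranslate`, `measurePreserving_configTranslate`; it commutes with the transfer matrix,
`wilsonTorusTransferMatrix_compMeasurePreserving_comm` — the typing prerequisite D1 of the stub plan, in the tree since
`WilsonTransferTranslations`). -/
def koopmanTranslate (N : ℕ) [NeZero N] (v : Site 3 N) :
    Lp ℝ 2 (Measure.pi fun _ : Edge 3 N => haarProbability G) → Lp ℝ 2 (Measure.pi fun _ : Edge 3 N => haarProbability G) :=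
  fun φ => Lp.compMeasurePreserving (configTranslate v) (measurePreserving_configTranslate v (haarProbability G)) φ

/-- The Koopman translation preserves inner products (it is a linear isometry, `Lp.compMeasurePreservingₗᵢ`). -/
theorem inner_koopmanTranslate (N : ℕ) [NeZero N] (v : Site 3 N) (φ φ' : Lp ℝ 2 (Measure.pi fun _ : Edge 3 N => haarProbability G)) :
    ⟪koopmanTranslate (G := G) N v φ, koopmanTranslate N v φ'⟫_ℝ = ⟪φ, φ'⟫_ℝ :=
  (Lp.compMeasurePreservingₗᵢ ℝ (configTranslate (G := G) v)
    (measurePreserving_configTranslate v (haarProbability G))).inner_map_map φ φ'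

/-- The **normalised effective hopping kernel** of a frame `ψ : (ℤ/N)³ × Fin n → L²`:
`J(z)_{ij} = ⟪ψ_{(0,i)}, 𝕋 ψ_{(z,j)}⟫ / λ₊` (`𝕋 = wilsonTorusTransferMatrix r.ρ β N`, `λ₊ = transferSpectralRadius r.ρ β N`) —
the real matrix kernel whose Bloch matrices are the momentum blocks of `𝕋/λ₊` on the span of a translation-covariant `ψ`. -/
def transferKernel (r : LatticeRep G) (β : ℝ) (N : ℕ) [NeZero N] {n : ℕ}
    (ψ : Site 3 N × Fin n → Lp ℝ 2 (Measure.pi fun _ : Edge 3 N => haarProbability G)) (z : Site 3 N) :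
    Matrix (Fin n) (Fin n) ℝ :=
  Matrix.of fun i j => (transferSpectralRadius r.ρ β N)⁻¹ * ⟪ψ (0, i), wilsonTorusTransferMatrix r.ρ β N (ψ (z, j))⟫_ℝ

/-- The **Bloch matrices of the transfer matrix** in the frame `ψ` at the torus momentum `p ∈ (ℤ/N)³`:
`B̂(p) = Σ_z e^{ip·z} J(z)` (complex `n × n`). -/
def transferBloch (r : LatticeRep G) (β : ℝ) (N : ℕ) [NeZero N] {n : ℕ}
    (ψ : Site 3 N × Fin n → Lp ℝ 2 (Measure.pi fun _ : Edge 3 N => haarProbability G)) (p : Site 3 N) :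
    Matrix (Fin n) (Fin n) ℂ :=
  blochMatrix (fun _ : Fin 3 => N) n (fun z => (transferKernel r β N ψ z).map Complex.ofReal) p

variable (r : LatticeRep G) (β : ℝ) (N : ℕ) [NeZero N] {n : ℕ}
  {ψ : Site 3 N × Fin n → Lp ℝ 2 (Measure.pi fun _ : Edge 3 N => haarProbability G)}

/-- **Translation invariance of the transfer kernel of a covariant frame**: if `ψ_{(v+x,j)} = U_v ψ_{(x,j)}` for the Koopman
translations `U_v`, then `⟪ψ_{(x,i)}, 𝕋 ψ_{(y,j)}⟫ = ⟪ψ_{(0,i)}, 𝕋 ψ_{(y−x,j)}⟫` (`U_v` is an isometry commuting with `𝕋`).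
[cite: MontvayMunster1994, §3.2.6] -/
theorem inner_transfer_covariant
    (hcov : ∀ (v x : Site 3 N) (j : Fin n), ψ (v + x, j) = koopmanTranslate N v (ψ (x, j)))
    (x y : Site 3 N) (i j : Fin n) :
    ⟪ψ (x, i), wilsonTorusTransferMatrix r.ρ β N (ψ (y, j))⟫_ℝ =
      ⟪ψ (0, i), wilsonTorusTransferMatrix r.ρ β N (ψ (y - x, j))⟫_ℝ := by
  haveI : SecondCountableTopology G :=
    (r.continuous.isClosedEmbedding r.injective).isEmbedding.secondCountableTopology
  have hx : ψ (x, i) = koopmanTranslate N x (ψ (0, i)) := by rw [← hcov x 0 i, add_zero]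
  have hy : ψ (y, j) = koopmanTranslate N x (ψ (y - x, j)) := by rw [← hcov x (y - x) j, add_sub_cancel]
  rw [hx, hy, koopmanTranslate, koopmanTranslate,
    wilsonTorusTransferMatrix_compMeasurePreserving_comm β N r.continuous x]
  exact inner_koopmanTranslate N x _ _

/-- The transfer kernel of a covariant frame is reflection-symmetric, `J(−z) = J(z)ᵀ` (`𝕋` is self-adjoint). -/
theorem transferKernel_reflect
    (hcov : ∀ (v x : Site 3 N) (j : Fin n), ψ (v + x, j) = koopmanTranslate N v (ψ (x, j))) (z : Site 3 N) :
    transferKernel r β N ψ (-z) = (transferKernel r β N ψ z)ᵀ := by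
  haveI : SecondCountableTopology G :=
    (r.continuous.isClosedEmbedding r.injective).isEmbedding.secondCountableTopology
  have hT := (isSelfAdjoint_wilsonTorusTransferMatrix N r.continuous r.mem_unitary β).isSymmetric
  ext i j
  simp only [transferKernel, Matrix.of_apply, Matrix.transpose_apply]
  congr 1
  have h1 := inner_transfer_covariant r β N hcov z 0 i j
  rw [zero_sub] at h1
  rw [← h1, ← ContinuousLinearMap.coe_coe, ← hT, ContinuousLinearMap.coe_coe, real_inner_comm]

/-- The Bloch matrices of the transfer matrix in a covariant frame are Hermitian. -/
theorem transferBloch_isHermitian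
    (hcov : ∀ (v x : Site 3 N) (j : Fin n), ψ (v + x, j) = koopmanTranslate N v (ψ (x, j))) (p : Site 3 N) :
    (transferBloch r β N ψ p).IsHermitian :=
  blochMatrix_isHermitian (map_ofReal_reflect (transferKernel_reflect r β N hcov)) p

/-- **Bloch reduction for the transfer matrix (stub S2, transfer-matrix form).**  For a translation-covariant orthonormal frame
`ψ_{(x,j)}` (`ψ_{(v+x,j)} = U_v ψ_{(x,j)}`) spanning a `𝕋`-invariant subspace and ANY orthonormal eigenbasis `e_k`
(`𝕋 e_k = μ_k e_k`) of that subspace: `Σ_k (μ_k/λ₊)^t = Σ_{p ∈ (ℤ/N)³} Re tr B̂(p)^t` for every `t` — the normalised band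
eigenvalues, with multiplicity, are the eigenvalues of the Hermitian Bloch blocks `B̂(p)` of the hopping kernel `J`.
[cite: MontvayMunster1994, §3.2.6] -/
theorem transfer_bloch_reduction (hψ : Orthonormal ℝ ψ)
    (hcov : ∀ (v x : Site 3 N) (j : Fin n), ψ (v + x, j) = koopmanTranslate N v (ψ (x, j)))
    (hinv : ∀ b, wilsonTorusTransferMatrix r.ρ β N (ψ b) ∈ Submodule.span ℝ (Set.range ψ))
    {K : Type*} [Fintype K] {e : K → Lp ℝ 2 (Measure.pi fun _ : Edge 3 N => haarProbability G)}
    (he : Orthonormal ℝ e) {μ : K → ℝ} (hμ : ∀ k, wilsonTorusTransferMatrix r.ρ β N (e k) = μ k • e k)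
    (he_mem : ∀ k, e k ∈ Submodule.span ℝ (Set.range ψ)) (hψ_mem : ∀ a, ψ a ∈ Submodule.span ℝ (Set.range e))
    (t : ℕ) :
    ∑ k, (μ k / transferSpectralRadius r.ρ β N) ^ t = ∑ p : Site 3 N, ((transferBloch r β N ψ p ^ t).trace).re := by
  set Λ : ℝ := transferSpectralRadius r.ρ β N with hΛ
  set T : Lp ℝ 2 (Measure.pi fun _ : Edge 3 N => haarProbability G) →ₗ[ℝ]
      Lp ℝ 2 (Measure.pi fun _ : Edge 3 N => haarProbability G) :=
    Λ⁻¹ • (wilsonTorusTransferMatrix r.ρ β N : _ →ₗ[ℝ] _) with hTdef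
  have hTapp : ∀ φ, T φ = Λ⁻¹ • wilsonTorusTransferMatrix r.ρ β N φ := fun φ => by
    rw [hTdef, LinearMap.smul_apply, ContinuousLinearMap.coe_coe]
  have hTψ : ∀ b, T (ψ b) ∈ Submodule.span ℝ (Set.range ψ) := fun b => by
    rw [hTapp]
    exact Submodule.smul_mem _ _ (hinv b)
  have hker : ∀ (x : Site 3 N) (i : Fin n) (y : Site 3 N) (j : Fin n),
      ⟪ψ (x, i), T (ψ (y, j))⟫_ℝ = transferKernel r β N ψ (y - x) i j := by
    intro x i y j
    rw [hTapp, real_inner_smul_right, inner_transfer_covariant r β N hcov, transferKernel, Matrix.of_apply]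
  have hTe : ∀ k, T (e k) = (μ k / Λ) • e k := fun k => by
    rw [hTapp, hμ, smul_smul, div_eq_inv_mul]
  exact sum_eigenvalue_pow_eq_sum_re_trace_blochMatrix_pow (N := fun _ : Fin 3 => N) T hψ hTψ hker he hTe he_mem hψ_mem t

/-- **The lower half of (P4) for the Bloch blocks of any covariant excited frame.**  With the data of
`transfer_bloch_reduction` and all `μ_k < λ₊` (an EXCITED invariant subspace), for `β ≥ 0` and every Euclidean time `m + 2`:
`Σ_{p ∈ (ℤ/N)³} Re tr B̂(p)^{m+2} ≤ traceExcess r.ρ β N (m+2)` — by the landed variational floor `sum_pow_div_le_traceExcess`.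
(Item ⟨stmt-QuantumFields-22957⟩ asks for `½·Σ_p Re tr B̃(θ_p)^{m+2} ≤ x_{m+2}`; here with constant `1` for the exact Bloch
blocks of the band.)  Nothing about the upper half (the dilute-gas bound, stub S4) or the existence of the band (stub S1) is
proved here. -/
theorem sum_re_trace_transferBloch_pow_le_traceExcess {β : ℝ} (hβ : 0 ≤ β) (hψ : Orthonormal ℝ ψ)
    (hcov : ∀ (v x : Site 3 N) (j : Fin n), ψ (v + x, j) = koopmanTranslate N v (ψ (x, j)))
    (hinv : ∀ b, wilsonTorusTransferMatrix r.ρ β N (ψ b) ∈ Submodule.span ℝ (Set.range ψ))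
    {K : Type*} [Fintype K] {e : K → Lp ℝ 2 (Measure.pi fun _ : Edge 3 N => haarProbability G)}
    (he : Orthonormal ℝ e) {μ : K → ℝ} (hμ : ∀ k, wilsonTorusTransferMatrix r.ρ β N (e k) = μ k • e k)
    (hlt : ∀ k, μ k < transferSpectralRadius r.ρ β N)
    (he_mem : ∀ k, e k ∈ Submodule.span ℝ (Set.range ψ)) (hψ_mem : ∀ a, ψ a ∈ Submodule.span ℝ (Set.range e))
    (m : ℕ) :
    ∑ p : Site 3 N, ((transferBloch r β N ψ p ^ (m + 2)).trace).re ≤ traceExcess r.ρ β N (m + 2) := by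
  rw [← transfer_bloch_reduction r β N hψ hcov hinv he hμ he_mem hψ_mem (m + 2)]
  exact sum_pow_div_le_traceExcess r hβ N e he μ hμ hlt m

end Transfer

/-! ### §7 The item's indexing: momenta `p ∈ (Fin N)³` and the lattice angles `θ_p = 2πp/N` -/

section Cube

open MeasureTheory
open Literature.MathematicalPhysics.QuantumFieldTheory
open Bloch

variable {N : ℕ} [NeZero N]

/-- The torus momentum / translation `(p₁, p₂, p₃) ↦ (i ↦ pᵢ mod N)` : `(Fin N)³ → (ℤ/N)³ = Site 3 N`. -/
def cubeToSite (p : Fin N × Fin N × Fin N) : Site 3 N := fun i => ((coordsF p i).val : ZMod N)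

/-- The inverse `(ℤ/N)³ → (Fin N)³`, `v ↦ (v₀.val, v₁.val, v₂.val)`. -/
def siteToCube (v : Site 3 N) : Fin N × Fin N × Fin N :=
  (⟨(v 0).val, ZMod.val_lt _⟩, ⟨(v 1).val, ZMod.val_lt _⟩, ⟨(v 2).val, ZMod.val_lt _⟩)

/-- `cubeToSite` and `siteToCube` are inverse bijections `(Fin N)³ ≃ (ℤ/N)³`. -/
def cubeEquivSite : (Fin N × Fin N × Fin N) ≃ Site 3 N where
  toFun := cubeToSite
  invFun := siteToCube
  left_inv p := by
    have h : ∀ a : Fin N, (⟨((a.val : ZMod N)).val, ZMod.val_lt _⟩ : Fin N) = a := fun a =>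
      Fin.ext (by simp only [ZMod.val_natCast, Nat.mod_eq_of_lt a.isLt])
    obtain ⟨p₁, p₂, p₃⟩ := p
    simp only [siteToCube, cubeToSite, coordsF, Matrix.cons_val_zero, Matrix.cons_val_one, Matrix.cons_val_two,
      Matrix.tail_cons, Matrix.head_cons, h]
  right_inv v := by
    funext i
    have h : ∀ j : Fin 3, (((coordsF (siteToCube v) j).val : ℕ) : ZMod N) = v j := by
      intro j
      fin_cases j <;> simp [siteToCube, coordsF]
    exact h i

/-- `cubeEquivSite p = cubeToSite p`. -/
@[simp] theorem cubeEquivSite_apply (p : Fin N × Fin N × Fin N) : cubeEquivSite p = cubeToSite p := rfl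

/-- **The characters at cube momenta are the lattice-angle phases**: `e^{ip·z} = exp(i Σ_μ θ_p(μ)·z_μ)` with
`θ_p = latticeAngle N p = 2πp/N` and `z_μ ∈ [0, N)` the standard representative — the convention linking the Bloch matrices
here to a `2π`-periodic symbol `B̃` evaluated at `latticeAngle N p` (stub S3): `B̃(θ_p) = B̂(cubeToSite p)` whenever
`B̃(q) = Σ_z exp(i Σ_μ q_μ z̃_μ) J(z)` with representatives `z̃_μ ≡ z_μ (mod N)`. -/
theorem chi_cubeToSite (p : Fin N × Fin N × Fin N) (z : Site 3 N) :
    chi (fun _ : Fin 3 => N) (cubeToSite p) z =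
      Complex.exp (Complex.I * (∑ μ : Fin 3, latticeAngle N p μ * ((z μ).val : ℝ) : ℝ)) := by
  unfold chi
  rw [Complex.ofReal_sum, Finset.mul_sum, Complex.exp_sum]
  refine Finset.prod_congr rfl fun μ _ => ?_
  have hmul : cubeToSite p μ * z μ = ((((coordsF p μ).val * (z μ).val : ℕ) : ℤ) : ZMod N) := by
    rw [Int.cast_natCast, Nat.cast_mul, ZMod.natCast_zmod_val, cubeToSite]
  rw [hmul, ZMod.stdAddChar_coe]
  congr 1
  simp only [latticeAngle]
  push_cast
  ring

/-- **The lower half of (P4) in the item's indexing.**  Under the hypotheses of `sum_re_trace_transferBloch_pow_le_traceExcess`: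
`Σ_{p ∈ (Fin N)³} Re tr B̂(cubeToSite p)^{m+2} ≤ traceExcess r.ρ β N (m+2)`. -/
theorem sum_cube_re_trace_transferBloch_pow_le_traceExcess
    {G : Type} [Group G] [TopologicalSpace G] [IsTopologicalGroup G] [CompactSpace G] [MeasurableSpace G] [BorelSpace G]
    (r : LatticeRep G) {β : ℝ} (hβ : 0 ≤ β) (N : ℕ) [NeZero N] {n : ℕ}
    {ψ : Site 3 N × Fin n → Lp ℝ 2 (Measure.pi fun _ : Edge 3 N => haarProbability G)} (hψ : Orthonormal ℝ ψ)
    (hcov : ∀ (v x : Site 3 N) (j : Fin n), ψ (v + x, j) = koopmanTranslate N v (ψ (x, j)))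
    (hinv : ∀ b, wilsonTorusTransferMatrix r.ρ β N (ψ b) ∈ Submodule.span ℝ (Set.range ψ))
    {K : Type*} [Fintype K] {e : K → Lp ℝ 2 (Measure.pi fun _ : Edge 3 N => haarProbability G)}
    (he : Orthonormal ℝ e) {μ : K → ℝ} (hμ : ∀ k, wilsonTorusTransferMatrix r.ρ β N (e k) = μ k • e k)
    (hlt : ∀ k, μ k < transferSpectralRadius r.ρ β N)
    (he_mem : ∀ k, e k ∈ Submodule.span ℝ (Set.range ψ)) (hψ_mem : ∀ a, ψ a ∈ Submodule.span ℝ (Set.range e))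
    (m : ℕ) :
    ∑ p : Fin N × Fin N × Fin N, ((transferBloch r β N ψ (cubeToSite p) ^ (m + 2)).trace).re ≤
      traceExcess r.ρ β N (m + 2) := by
  rw [Fintype.sum_equiv cubeEquivSite (fun p => ((transferBloch r β N ψ (cubeToSite p) ^ (m + 2)).trace).re)
    (fun q : Site 3 N => ((transferBloch r β N ψ q ^ (m + 2)).trace).re) (fun p => rfl)]
  exact sum_re_trace_transferBloch_pow_le_traceExcess r N hβ hψ hcov hinv he hμ hlt he_mem hψ_mem m

end Cube

end Summit.QuantumFields.YangMills.Theorems.GlueballBandRecursion.Band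

end
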